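import Summits.BirchSwinnertonDyer.BirchSwinnertonDyer.Theorems.Rank2Observatory2DescClRealKillCertE2Defs
import Summits.BirchSwinnertonDyer.BirchSwinnertonDyer.Theorems.Rank2Observatory2DescClSubCurveCertE2Defs
import HarnessLib

/-!
# BirchSwinnertonDyer — rank ≥ 2 observatory: KERNEL-2DESC-CL v2.8-REAL — the two-view kill-list certificate with the SUBGROUP SIEVE (totally real case), part 1/3: the checker

HONEST FRAMING: per-curve certified theorems and census instruments; no claim on BSD in rank ≥ 2.

The totally real signature of `…ClSubCurveCertE2Defs` (v2.8): `checkE2RKS G ccr r ks sv` = the clauses of the v2.7 totally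
real kill-list checker `checkE2RK G ccr r ks` (`…ClRealKillCertE2Defs`) VERBATIM except its final count, which is replaced
by the subgroup sieve of `…ClSubgroupSieve`: every class passing `admR2K G ccr ks` is listed in `sv` (index lists into
`fam2 ccr.cc`, `survCls` of the complex file) and the search `noSubB (· ∈ live) live (r+1) [∅]` over the live classes
succeeds — no `∆`-closed family of `2^(r+1)` surviving classes exists.  For a totally real row whose three-place sieve
admits SIXTEEN classes (census dimVR = 4) a rank-2 certificate then needs three killed classes `c₁, c₂, c₁c₂` outside the
image instead of nine.  Soundness is part 2 (`…ClRealSubCertE2`), row shapes part 3.  New declarations only; sorry-free.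
[cite: Cassels1991LecturesEllipticCurves, §15] [cite: CremonaAlgorithms1997, §3.6] [cite: Cohen1993, §4.8.2, §6.2, §6.5]
[cite: Marcus2018, Ch. 5, Thm. 38] [cite: SilvermanAEC2009, X.1.1]
-/

set_option linter.dupNamespace false

noncomputable section

open Polynomial NumberField IsDedekindDomain Module
open Literature.NumberTheory.NumberFields   -- OPENFIX (cert-1 gen 35): `MonicCubic.*` lives in this namespace; the line was missing (inlined-head prechecks leaked it from `…ClRealCertE`)

namespace Summit.BirchSwinnertonDyer.BirchSwinnertonDyer.Rank2Observatory.TwoDescCl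

open TwoDescCubic ClFieldCert

section Checkers

variable (G : ClFieldCertRE2) (ccr : ClCurveCertE2R)

/-- The LIVE classes of a totally real row: the listed classes `sv` that pass the sieve `admR2K` (computed once).
[folklore] -/
def liveE2RKS (ks : List ClKillE2) (sv : List (List ℕ)) : List (Finset (Fin (fam2 ccr.cc).length)) :=
  (sv.map (survCls ccr.cc)).filter fun V => admR2K G ccr ks ∅ V

/-- **The totally real two-view per-curve `r`-checker with a kill list and the SUBGROUP SIEVE**: the clauses of
`checkE2RK G ccr r ks` except its count, verbatim; then: every class passing `admR2K` is listed in `sv`, and the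
subgroup-sieve search `noSubB` of depth `r + 1` over the live classes succeeds.  Computable; run by `decide +kernel`.
[cite: Cassels1991LecturesEllipticCurves, §15] [cite: CremonaAlgorithms1997, §3.6] -/
def checkE2RKS (r : ℕ) (ks : List ClKillE2) (sv : List (List ℕ)) : Bool :=
  decide (deltaShort ccr.cc.A ccr.cc.B ccr.cc.C ≠ 0) &&
    noRootMod ccr.cc.pF ccr.cc.A ccr.cc.B ccr.cc.C &&
    decide (cubicAtCoords G.toE2.fe.base.a G.toE2.fe.base.b G.toE2.fe.base.c ((G.toE2.m₁ : ℤ) * ccr.cc.A)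
      ((G.toE2.m₁ : ℤ) ^ 2 * ccr.cc.B) ((G.toE2.m₁ : ℤ) ^ 3 * ccr.cc.C) ccr.cc.Xt = (0, 0, 0)) &&
    decide (derivAtCoords G.toE2.fe.base.a G.toE2.fe.base.b G.toE2.fe.base.c ((G.toE2.m₁ : ℤ) * ccr.cc.A)
      ((G.toE2.m₁ : ℤ) ^ 2 * ccr.cc.B) ccr.cc.Xt =
      MonicCubic.mulCoords G.toE2.fe.base.a G.toE2.fe.base.b G.toE2.fe.base.c (smulCoords (G.toE2.m₁ : ℤ) ccr.cc.XD)
        (prodPowCoords G.toE2.fe.base.a G.toE2.fe.base.b G.toE2.fe.base.c [])) &&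
    twoViewCheck G.toE2.fe.base.a G.toE2.fe.base.b G.toE2.fe.base.c G.toE2.fe.u G.toE2.fe.d G.toE2.m₁ G.toE2.m₂
      ccr.cc.Xt ccr.cc.Yt &&
    twoViewCheck G.toE2.fe.base.a G.toE2.fe.base.b G.toE2.fe.base.c G.toE2.fe.u G.toE2.fe.d G.toE2.m₁ G.toE2.m₂
      ccr.cc.XD ccr.cc.YD &&
    decide (0 < MonicCubic.disc ccr.cc.A ccr.cc.B ccr.cc.C) &&
    decide (normFormZ G.toE2.fe.base.a G.toE2.fe.base.b G.toE2.fe.base.c ccr.cc.XD.1 ccr.cc.XD.2.1 ccr.cc.XD.2.2 ≠ 0) &&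
    decide ((normFormZ G.toE2.fe.base.a G.toE2.fe.base.b G.toE2.fe.base.c ccr.cc.XD.1 ccr.cc.XD.2.1
      ccr.cc.XD.2.2).natAbs = (ccr.cc.dn.map fun pe => pe.1 ^ pe.2).prod) &&
    (ccr.cc.dn.all fun pe => primeDispatch G.toE2 ccr.cc ccr.cc.XD ccr.cc.YD ccr.cc.dinvA ccr.cc.dinvE pe.1) &&
    (ccr.cc.codes.all fun bc => codeClause G.toE2 ccr.cc bc) &&
    invCert G.toE2.fe.base.a G.toE2.fe.base.b G.toE2.fe.base.c G.toE2.fe.base.w₁ ccr.cc.XD ccr.cc.dW1 &&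
    invCert G.toE2.fe.base.a G.toE2.fe.base.b G.toE2.fe.base.c G.toE2.fe.base.w₂ ccr.cc.XD ccr.cc.dW2 &&
    (ccr.cc.Q.all fun q => decide (0 < q)) &&
    decide (ccr.cc.head.length = 5) &&
    ((fam2 ccr.cc).all fun f => famCheckE2R G ccr f) &&
    (linLtCond (G.fre.re.I ccr.o₀).1 (G.fre.re.I ccr.o₀).2 (G.fre.re.I ccr.o₁).1 (G.fre.re.I ccr.o₁).2 ccr.cc.Xt &&
      linLtCond (G.fre.re.I ccr.o₁).1 (G.fre.re.I ccr.o₁).2 (G.fre.re.I ccr.o₂).1 (G.fre.re.I ccr.o₂).2 ccr.cc.Xt) &&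
    decide (∀ T : Finset (Fin (fam2 ccr.cc).length), T ≠ ∅ →
      ∃ k : Fin (G.toE2.fe.base.chars.length + 5), Odd (T.filter fun j => bitR2 G ccr k j = true).card) &&
    (ks.all fun k => k.lite G.toE2 ccr.cc) &&
    decide (∀ U : Finset (Fin (fam2 ccr.cc).length), admR2K G ccr ks ∅ U = true → U ∈ sv.map (survCls ccr.cc)) &&
    noSubB (fun U => decide (U ∈ liveE2RKS G ccr ks sv)) (liveE2RKS G ccr ks sv) (r + 1) [∅]

end Checkers

end Summit.BirchSwinnertonDyer.BirchSwinnertonDyer.Rank2Observatory.TwoDescCl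

end
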